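import Summits.BirchSwinnertonDyer.BirchSwinnertonDyer.Theorems.AlignedTransportAtTwoMainConjectureOfRankZeroBSDAtTwoFineRoadExactAccounting
import Summits.BirchSwinnertonDyer.BirchSwinnertonDyer.Theorems.AlignedTransportAtTwoMainConjectureOfRankZeroBSDAtTwoFineRoadRelaxedFine
import HarnessLib

/-!
# Route `AlignedTransportAtTwo`, crux C2 `MainConjectureOfRankZeroBSDAtTwo` (stmt-BirchSwinnertonDyer-22298):
# road (b) over `ℚ_∞` — the zeta index from a REAL-SIGNATURE functional (the `Δ_E > 0` bit), and `Δ_E < 0`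

HONEST FRAMING (cell `bsd-f1-sign2`, WIDTH-5 attached prover seat `bsd-line-att-p3` gen 3, line `birth` of the
lead `bsd-line-att-p2`; BSD is NOT proved by any of this). THEOREMS ONLY; nothing asserted. Continuation of
`…FineRoadExactAccounting` (p602804): there, under the displayed exact Kato row over `ℚ_∞`, statement (A) and
the even-branch `μ₂ = 0`, stub T ⟺ `ℓ₍₂₎(𝐇/Λz⁺) = e` (`e = [Δ_E > 0]`, REF1 §57). REF1-AUDIT §62 (S1) explains
where one unit of zeta index comes from when `Δ_E > 0`: the real-signature map
`loc_∞ : 𝐇 = H¹_Iw(ℚ_∞, T₂E) → lim_n ⊕_{v∣∞} H¹(ℚ_{n,v}, T₂E) ≅ Λ/2Λ` is `Λ`-linear, KILLS Kato's class `z⁺`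
(a corestriction from the totally imaginary `ℚ(ζ_{2^∞})` has trivial real components), and IF it is non-zero
its image is a non-zero submodule of `Λ/2Λ = 𝔽₂⟦T⟧`, of `(2)`-length `1`, so `ℓ₍₂₎(𝐇/Λz⁺) ≥ 1 = e` and T
follows. «`loc_∞ ≢ 0`» is att-p4 g2's bit `b(E) = 0` (`RealSignatureAtTwo`); by REF1 §62 (S2) it follows from
Iwasawa's `μ₂ = 0` for `ℚ(E[2], ζ₄)` (skeleton v6's PFμ⁺). Everything is DISPLAYED; this file is the algebra.

* §1 `lengthAt_eq_one_of_ne_bot` — a non-zero submodule of `Λ₀/(p)` has `(p)`-length `1`;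
  `one_le_lengthAt_quotient_span_of_signature` — a `Λ₀`-linear `sig : H → Λ₀/(p)` with `sig z = 0`, `sig ≠ 0`
  forces `1 ≤ ℓ₍ₚ₎(H/Λ₀z)`.
* §2 at `2`, per cyclotomic datum: `selmerDual_mu_eq_zero_of_signature_two` — exact Kato row over `ℚ_∞` with
  `col (loc z) = 2·s·G₊` (`Δ_E > 0` shape), (A), `red G₊ ≠ 0`, `(2)`-length-`0` Coleman cokernel, and a signature
  functional killing `z` and non-zero ⟹ `μ(X(E/ℚ_∞)) = 0`; `selmerDual_mu_eq_zero_of_exact_defectZero_two` —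
  the `Δ_E < 0` shape `col (loc z) = s·G₊` gives `μ = 0` outright (road (b) EXACT closes T for `Δ_E < 0` modulo
  the displayed PRINT-shaped data + (A)); `lengthAt_zetaIndex_eq_one_of_signature_two` — conversely-flavoured
  bookkeeping: under the same data the zeta index is EXACTLY `1`.
* §3 `muInequalityRelAtTwo_of_muInequalityAtTwo` — skeleton bookkeeping: v5's registered strict stub MuIneq IMPLIES
  v6's relaxed stub MuIneqʳ (att-p4 g3's `RelaxedRestrict.lengthAt_fine_le_lengthAt_relaxed`: `ℓ(X₀) ≤ ℓ(X₀^{rel∞})`,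
  the restriction being onto) — the netted road asks LESS of Kato's side than v5 did; bodies verbatim.

References: K. Kato, Astérisque 295 (2004), Thm. 12.4, §17.13; R. Greenberg, LNM 1716 (1999), §4 (real places at
`p = 2`); B. Mazur, K. Rubin, *Kolyvagin systems* (2004), Thm. 2.3.4 (comparison of Selmer structures);
J. Coates, R. Sujatha, Math. Ann. 331 (2005) §3.
-/

set_option linter.dupNamespace false
set_option autoImplicit false

noncomputable section

open scoped Classical

open Literature.NumberTheory.EllipticCurves Literature.NumberTheory.EllipticCurves.Module

namespace Summit.BirchSwinnertonDyer.BirchSwinnertonDyer.Theorems.AlignedTransportAtTwoFineRoad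

/-! ## §1 Submodules of `Λ₀/(p)` and signature functionals -/

section Signature

variable (p : ℕ) [Fact p.Prime]

/-- **A non-zero submodule of `Λ₀/(p) = 𝔽_p⟦T⟧` has `(p)`-length `1`.** (`ℓ_{(p)}(Λ₀/(p)) = 1`, and the quotient
by a non-zero submodule is `Λ₀/J` with `J ⊋ (p)`, of `(p)`-length `0`.) [folklore] -/
theorem lengthAt_eq_one_of_ne_bot
    (N : Submodule (IwasawaAlgebra p) (IwasawaAlgebra p ⧸ IwasawaAlgebra.augIdealP p)) (hN : N ≠ ⊥) :
    lengthAt (IwasawaAlgebra p) N ⟨IwasawaAlgebra.augIdealP p, IwasawaAlgebra.isPrime_augIdealP_holds p⟩ = 1 := by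
  let 𝔭 : PrimeSpectrum (IwasawaAlgebra p) :=
    ⟨IwasawaAlgebra.augIdealP p, IwasawaAlgebra.isPrime_augIdealP_holds p⟩
  -- `N = J/I` with `J = comap mkQ N ⊋ I`
  have hIJ : (IwasawaAlgebra.augIdealP p : Submodule (IwasawaAlgebra p) (IwasawaAlgebra p)) ≤
      N.comap (IwasawaAlgebra.augIdealP p).mkQ := by
    intro x hx
    rw [Submodule.mem_comap, Submodule.mkQ_apply,
      (Submodule.Quotient.mk_eq_zero (IwasawaAlgebra.augIdealP p)).mpr hx]
    exact N.zero_mem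
  have hNJ : N = (N.comap (IwasawaAlgebra.augIdealP p).mkQ).map (IwasawaAlgebra.augIdealP p).mkQ := by
    rw [Submodule.map_comap_eq_of_surjective (Submodule.mkQ_surjective _)]
  have hJnot : ¬ N.comap (IwasawaAlgebra.augIdealP p).mkQ ≤ 𝔭.asIdeal := by
    intro hle
    apply hN
    rw [eq_bot_iff]
    intro n hn
    obtain ⟨x, rfl⟩ := Submodule.mkQ_surjective (IwasawaAlgebra.augIdealP p) n
    have hx : x ∈ N.comap (IwasawaAlgebra.augIdealP p).mkQ := Submodule.mem_comap.mpr hn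
    exact (Submodule.Quotient.mk_eq_zero _).mpr (hle hx)
  have hquot : lengthAt (IwasawaAlgebra p) ((IwasawaAlgebra p ⧸ IwasawaAlgebra.augIdealP p) ⧸ N) 𝔭 = 0 := by
    rw [lengthAt_eq_of_linearEquiv (Submodule.quotEquivOfEq _ _ hNJ) 𝔭,
      lengthAt_eq_of_linearEquiv (Submodule.quotientQuotientEquivQuotient _ _ hIJ) 𝔭]
    exact lengthAt_quotient_eq_zero_of_not_le hJnot
  have htot : lengthAt (IwasawaAlgebra p) (IwasawaAlgebra p ⧸ IwasawaAlgebra.augIdealP p) 𝔭 = 1 :=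
    lengthAt_quotient_self 𝔭
  rw [lengthAt_eq_add_quotient N 𝔭, hquot, add_zero] at htot
  exact htot

variable {H : Type*} [AddCommGroup H] [_root_.Module (IwasawaAlgebra p) H]

/-- **A signature functional bounds the zeta index from below.** A `Λ₀`-linear `sig : H → Λ₀/(p)` that KILLS
`z` and is NOT identically zero forces `1 ≤ ℓ_{(p)}(H/Λ₀·z)` (`H/Λ₀z ↠ H/ker sig ≅ im sig ≠ 0` inside `Λ₀/(p)`).
At `p = 2`: `sig = loc_∞` on `𝐇 = H¹_Iw(ℚ_∞, T₂E)` for `Δ_E > 0`, `z = z⁺` Kato's corestricted class.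
[cite: GreenbergLNM1716, §4 (real places at p = 2, pp. 98–99)] [cite: MazurRubin2004, Thm. 2.3.4] -/
theorem one_le_lengthAt_quotient_span_of_signature
    (sig : H →ₗ[IwasawaAlgebra p] (IwasawaAlgebra p ⧸ IwasawaAlgebra.augIdealP p)) {z : H} (hz : sig z = 0)
    (hsig : sig ≠ 0) :
    1 ≤ lengthAt (IwasawaAlgebra p) (H ⧸ (IwasawaAlgebra p ∙ z))
      ⟨IwasawaAlgebra.augIdealP p, IwasawaAlgebra.isPrime_augIdealP_holds p⟩ := by
  let 𝔭 : PrimeSpectrum (IwasawaAlgebra p) :=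
    ⟨IwasawaAlgebra.augIdealP p, IwasawaAlgebra.isPrime_augIdealP_holds p⟩
  have hN : LinearMap.range sig ≠ ⊥ := by
    intro h
    exact hsig (LinearMap.range_eq_bot.mp h)
  have h1 : lengthAt (IwasawaAlgebra p) (LinearMap.range sig) 𝔭 = 1 := lengthAt_eq_one_of_ne_bot p _ hN
  have hle : (IwasawaAlgebra p ∙ z) ≤ LinearMap.ker sig := by
    rw [Submodule.span_singleton_le_iff_mem, LinearMap.mem_ker]
    exact hz
  have h2 : lengthAt (IwasawaAlgebra p) (H ⧸ LinearMap.ker sig) 𝔭 ≤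
      lengthAt (IwasawaAlgebra p) (H ⧸ (IwasawaAlgebra p ∙ z)) 𝔭 :=
    lengthAt_le_of_surjective (Submodule.factor hle) (Submodule.factor_surjective hle) 𝔭
  rw [lengthAt_eq_of_linearEquiv sig.quotKerEquivRange 𝔭, h1] at h2
  exact h2

end Signature

/-! ## §2 At `2`, per cyclotomic datum -/

section AtTwo

open WeierstrassCurve Summit.BirchSwinnertonDyer.Rank1Residual.X1.MuLambda

variable (W : WeierstrassCurve ℚ) {κ : ZpExtension ℚ 2} {γ : Field.absoluteGaloisGroup ℚ}

/-- **`Δ_E > 0` shape: T from a signature functional.** GIVEN (displayed, not asserted): Kato's exact row over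
`ℚ_∞` (`𝐇 ↪ P`, `𝐇 → P → X(E/ℚ_∞) → X₀(E/ℚ_∞) → 0`), an injective Coleman map with `(2)`-length-`0` cokernel,
the integral class with `col (loc z) = 2·s·G₊` (`s ∉ (2)`; REF1 §57 at `Δ_E > 0`), `red G₊ ≠ 0`, statement (A) at
`(E,2)`, AND a `Λ`-linear functional `sig : 𝐇 → Λ/2` with `sig z = 0` (corestriction from `ℚ(ζ_{2^∞})` kills real
components) which is NOT zero (att-p4's `RealSignatureAtTwo`; ⟸ Iwasawa `μ₂ = 0` of `ℚ(E[2], ζ₄)` by REF1 §62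
(S2)) — THEN `μ(X(E/ℚ_∞)) = 0`. [cite: Kato2004Asterisque, Thm. 12.4, §17.13 (pp. 279–280)]
[cite: GreenbergLNM1716, Lemma 4.6 and pp. 98–99] [cite: CoatesSujatha2005, statement (A) (§3)] -/
theorem selmerDual_mu_eq_zero_of_signature_two (hγ : κ.IsTopGenerator γ) (D : W.SelmerDualData κ γ)
    (Yd : W.FineSelmerDualData κ γ) (hA : Set.Finite {s : W.fineSelmerInfty κ | 2 • s = 0})
    {G : IwasawaAlgebra 2} (hred : red G ≠ 0)
    {H P : Type*} [AddCommGroup H] [_root_.Module (IwasawaAlgebra 2) H]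
    [AddCommGroup P] [_root_.Module (IwasawaAlgebra 2) P]
    (loc : H →ₗ[IwasawaAlgebra 2] P) (hloc : Function.Injective loc) (toX : P →ₗ[IwasawaAlgebra 2] D.X)
    (hHP : Function.Exact loc toX) (π : D.X →ₗ[IwasawaAlgebra 2] Yd.X) (hX : Function.Exact toX π)
    (hπ : Function.Surjective π) (col : P →ₗ[IwasawaAlgebra 2] IwasawaAlgebra 2) (hcol : Function.Injective col)
    (hcoker : lengthAt (IwasawaAlgebra 2) (IwasawaAlgebra 2 ⧸ LinearMap.range col)
      ⟨IwasawaAlgebra.augIdealP 2, IwasawaAlgebra.isPrime_augIdealP_holds 2⟩ = 0)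
    {z : H} {s : IwasawaAlgebra 2} (hs : s ∉ IwasawaAlgebra.augIdealP 2)
    (hz : col (loc z) = PowerSeries.C (2 : ℤ_[2]) * s * G)
    (sig : H →ₗ[IwasawaAlgebra 2] (IwasawaAlgebra 2 ⧸ IwasawaAlgebra.augIdealP 2)) (hsigz : sig z = 0)
    (hsig : sig ≠ 0) : D.mu = 0 := by
  let 𝔭 : PrimeSpectrum (IwasawaAlgebra 2) :=
    ⟨IwasawaAlgebra.augIdealP 2, IwasawaAlgebra.isPrime_augIdealP_holds 2⟩
  have hz' : col (loc z) = PowerSeries.C ((2 : ℤ_[2]) ^ 1) * s * G := by rw [pow_one]; exact hz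
  have h := selmerDual_lengthAt_add_zetaIndex_eq_two W hγ D Yd hA hred loc hloc toX hHP π hX hπ col hcol hcoker
    hs hz'
  have h1 : 1 ≤ lengthAt (IwasawaAlgebra 2) (H ⧸ (IwasawaAlgebra 2 ∙ z)) 𝔭 :=
    one_le_lengthAt_quotient_span_of_signature 2 sig hsigz hsig
  have hH1 : lengthAt (IwasawaAlgebra 2) (H ⧸ (IwasawaAlgebra 2 ∙ z)) 𝔭 = 1 :=
    le_antisymm (by exact_mod_cast le_of_add_le_left h.le) h1
  rw [hH1] at h
  have h' : (1 : ℕ∞) + lengthAt (IwasawaAlgebra 2) D.X 𝔭 ≤ 1 + 0 := by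
    rw [add_zero]; exact_mod_cast h.le
  have hX0 : lengthAt (IwasawaAlgebra 2) D.X 𝔭 = 0 :=
    nonpos_iff_eq_zero.mp ((ENat.add_le_add_iff_left ENat.one_ne_top).mp h')
  change muInvariant 2 D.X = 0
  rw [muInvariant_eq_toNat_lengthAt 2 D.X 𝔭 rfl, hX0]
  rfl

/-- **`Δ_E < 0` shape: T outright on the exact road (b).** With `col (loc z) = s·G₊` (`s ∉ (2)`: NO `2` in the
unit equation — REF1 §57 at `Δ_E < 0`), the exact row, `(2)`-length-`0` Coleman cokernel, `red G₊ ≠ 0` and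
statement (A) give `μ(X(E/ℚ_∞)) = 0` (and `ℓ₍₂₎(𝐇/Λz) = 0`). Displayed data; nothing asserted.
[cite: Kato2004Asterisque, Thm. 12.4, Thm. 16.6, §17.13 (pp. 279–280)] [cite: CoatesSujatha2005, statement (A) (§3)] -/
theorem selmerDual_mu_eq_zero_of_exact_defectZero_two (hγ : κ.IsTopGenerator γ) (D : W.SelmerDualData κ γ)
    (Yd : W.FineSelmerDualData κ γ) (hA : Set.Finite {s : W.fineSelmerInfty κ | 2 • s = 0})
    {G : IwasawaAlgebra 2} (hred : red G ≠ 0)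
    {H P : Type*} [AddCommGroup H] [_root_.Module (IwasawaAlgebra 2) H]
    [AddCommGroup P] [_root_.Module (IwasawaAlgebra 2) P]
    (loc : H →ₗ[IwasawaAlgebra 2] P) (hloc : Function.Injective loc) (toX : P →ₗ[IwasawaAlgebra 2] D.X)
    (hHP : Function.Exact loc toX) (π : D.X →ₗ[IwasawaAlgebra 2] Yd.X) (hX : Function.Exact toX π)
    (hπ : Function.Surjective π) (col : P →ₗ[IwasawaAlgebra 2] IwasawaAlgebra 2) (hcol : Function.Injective col)
    (hcoker : lengthAt (IwasawaAlgebra 2) (IwasawaAlgebra 2 ⧸ LinearMap.range col)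
      ⟨IwasawaAlgebra.augIdealP 2, IwasawaAlgebra.isPrime_augIdealP_holds 2⟩ = 0)
    {z : H} {s : IwasawaAlgebra 2} (hs : s ∉ IwasawaAlgebra.augIdealP 2) (hz : col (loc z) = s * G) :
    D.mu = 0 := by
  let 𝔭 : PrimeSpectrum (IwasawaAlgebra 2) :=
    ⟨IwasawaAlgebra.augIdealP 2, IwasawaAlgebra.isPrime_augIdealP_holds 2⟩
  have hz' : col (loc z) = PowerSeries.C ((2 : ℤ_[2]) ^ 0) * s * G := by rw [pow_zero, map_one, one_mul]; exact hz
  have h := selmerDual_lengthAt_le_defect_two W hγ D Yd hA hred loc hloc toX hHP π hX hπ col hcol hcoker hs hz'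
  have hX0 : lengthAt (IwasawaAlgebra 2) D.X 𝔭 = 0 := nonpos_iff_eq_zero.mp (by exact_mod_cast h)
  change muInvariant 2 D.X = 0
  rw [muInvariant_eq_toNat_lengthAt 2 D.X 𝔭 rfl, hX0]
  rfl

/-- **Bookkeeping: with a signature functional the zeta index is EXACTLY one** (`Δ_E > 0` shape; same
displayed data as `selmerDual_mu_eq_zero_of_signature_two`): `ℓ₍₂₎(𝐇/Λz) = 1` — Kato's `ℚ_∞`-class is
`μ`-divisible exactly once, the algebraic face of REF1 §57's period `2`. [cite: Kato2004Asterisque, §17.13 (pp. 279–280)]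
[cite: GreenbergLNM1716, Lemma 4.6 and pp. 98–99] -/
theorem lengthAt_zetaIndex_eq_one_of_signature_two (hγ : κ.IsTopGenerator γ) (D : W.SelmerDualData κ γ)
    (Yd : W.FineSelmerDualData κ γ) (hA : Set.Finite {s : W.fineSelmerInfty κ | 2 • s = 0})
    {G : IwasawaAlgebra 2} (hred : red G ≠ 0)
    {H P : Type*} [AddCommGroup H] [_root_.Module (IwasawaAlgebra 2) H]
    [AddCommGroup P] [_root_.Module (IwasawaAlgebra 2) P]
    (loc : H →ₗ[IwasawaAlgebra 2] P) (hloc : Function.Injective loc) (toX : P →ₗ[IwasawaAlgebra 2] D.X)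
    (hHP : Function.Exact loc toX) (π : D.X →ₗ[IwasawaAlgebra 2] Yd.X) (hX : Function.Exact toX π)
    (hπ : Function.Surjective π) (col : P →ₗ[IwasawaAlgebra 2] IwasawaAlgebra 2) (hcol : Function.Injective col)
    (hcoker : lengthAt (IwasawaAlgebra 2) (IwasawaAlgebra 2 ⧸ LinearMap.range col)
      ⟨IwasawaAlgebra.augIdealP 2, IwasawaAlgebra.isPrime_augIdealP_holds 2⟩ = 0)
    {z : H} {s : IwasawaAlgebra 2} (hs : s ∉ IwasawaAlgebra.augIdealP 2)
    (hz : col (loc z) = PowerSeries.C (2 : ℤ_[2]) * s * G)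
    (sig : H →ₗ[IwasawaAlgebra 2] (IwasawaAlgebra 2 ⧸ IwasawaAlgebra.augIdealP 2)) (hsigz : sig z = 0)
    (hsig : sig ≠ 0) :
    lengthAt (IwasawaAlgebra 2) (H ⧸ (IwasawaAlgebra 2 ∙ z))
      ⟨IwasawaAlgebra.augIdealP 2, IwasawaAlgebra.isPrime_augIdealP_holds 2⟩ = 1 := by
  let 𝔭 : PrimeSpectrum (IwasawaAlgebra 2) :=
    ⟨IwasawaAlgebra.augIdealP 2, IwasawaAlgebra.isPrime_augIdealP_holds 2⟩
  have hz' : col (loc z) = PowerSeries.C ((2 : ℤ_[2]) ^ 1) * s * G := by rw [pow_one]; exact hz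
  have h := selmerDual_lengthAt_add_zetaIndex_eq_two W hγ D Yd hA hred loc hloc toX hHP π hX hπ col hcol hcoker
    hs hz'
  have h1 : 1 ≤ lengthAt (IwasawaAlgebra 2) (H ⧸ (IwasawaAlgebra 2 ∙ z)) 𝔭 :=
    one_le_lengthAt_quotient_span_of_signature 2 sig hsigz hsig
  exact le_antisymm (by exact_mod_cast le_of_add_le_left h.le) h1

end AtTwo

/-! ## §3 Skeleton bookkeeping: v5's MuIneq ⟹ v6's MuIneqʳ -/

section Skeleton

open CongruenceSubgroup WeierstrassCurve Literature.NumberTheory.EllipticCurves.ModularForms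
  Literature.NumberTheory.EllipticCurves.Greenberg1999
  Literature.NumberTheory.EllipticCurves.Rank1Residual
  Literature.NumberTheory.IwasawaTheory
  Summit.BirchSwinnertonDyer.Rank1Residual Summit.BirchSwinnertonDyer.Rank1Residual.X1.MuLambda
  Summit.BirchSwinnertonDyer.Rank1Residual.X5 Summit.BirchSwinnertonDyer.Rank1Residual.F1Sign2
  Summit.BirchSwinnertonDyer.BirchSwinnertonDyer.Theorems.Rank1ResidualX1Defs
  Summit.BirchSwinnertonDyer.BirchSwinnertonDyer.Theses.AlignedTransportAtTwo

/-- **v5's strict `μ`-inequality implies v6's relaxed one** (bodies of the registered stubs `MuInequalityAtTwo` (v5)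
and `MuInequalityRelAtTwo` (v6) verbatim): `ℓ₍₂₎(X₀(W/ℚ_∞)) ≤ ℓ₍₂₎(X₀^{rel∞}(W/ℚ_∞))` because the restriction
`X₀^{rel∞} ↠ X₀` is onto (att-p4 g3, `…FineRoadRelaxedFine`). So the netted road (b″) asks no more of Kato's side
than v5 did; what it adds lives in Limʳ/PFμ⁺. [cite: GreenbergLNM1716, §4 Lemma 4.6 and pp. 98–99]
[cite: Kato2004Asterisque, §17.13 (pp. 279–280)] -/
theorem muInequalityRelAtTwo_of_muInequalityAtTwo
    (hI : ∀ (W : WeierstrassCurve ℚ) [W.IsElliptic] [W.IsGloballyMinimal], IsOrdinaryAt W 2 →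
      (∀ x : ℚ, ¬ HasRationalTwoTorsionX W x) →
      ∀ (κ : ZpExtension ℚ 2) (γ : Field.absoluteGaloisGroup ℚ), κ.IsCyclotomic →
      κ.IsTopGenerator γ → IsCyclotomicVariable 2 γ →
      ∀ ⦃N : ℕ⦄ [NeZero N] (f : CuspForm (Gamma0 N) 2), IsNewformOf W f →
      ∀ Gp : IwasawaAlgebra 2, iwasawaToPowerSeries 2 Gp = padicLFunction f (unitRoot W 2 : ℚ_[2]) →
      ∀ (D : W.SelmerDualData κ γ) (Yd : W.FineSelmerDualData κ γ),
        Literature.NumberTheory.EllipticCurves.Module.lengthAt (IwasawaAlgebra 2) D.X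
            ⟨IwasawaAlgebra.augIdealP 2, IwasawaAlgebra.isPrime_augIdealP_holds 2⟩ ≤
          Literature.NumberTheory.EllipticCurves.Module.lengthAt (IwasawaAlgebra 2)
              (IwasawaAlgebra 2 ⧸ Ideal.span {Gp})
              ⟨IwasawaAlgebra.augIdealP 2, IwasawaAlgebra.isPrime_augIdealP_holds 2⟩ +
            Literature.NumberTheory.EllipticCurves.Module.lengthAt (IwasawaAlgebra 2) Yd.X
              ⟨IwasawaAlgebra.augIdealP 2, IwasawaAlgebra.isPrime_augIdealP_holds 2⟩) :
    ∀ (W : WeierstrassCurve ℚ) [W.IsElliptic] [W.IsGloballyMinimal], IsOrdinaryAt W 2 →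
      (∀ x : ℚ, ¬ HasRationalTwoTorsionX W x) →
      ∀ (κ : ZpExtension ℚ 2) (γ : Field.absoluteGaloisGroup ℚ), κ.IsCyclotomic →
      κ.IsTopGenerator γ → IsCyclotomicVariable 2 γ →
      ∀ ⦃N : ℕ⦄ [NeZero N] (f : CuspForm (Gamma0 N) 2), IsNewformOf W f →
      ∀ Gp : IwasawaAlgebra 2, iwasawaToPowerSeries 2 Gp = padicLFunction f (unitRoot W 2 : ℚ_[2]) →
      ∀ (D : W.SelmerDualData κ γ) (Yr : W.FineSelmerDualDataRelaxedInf κ γ),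
        Literature.NumberTheory.EllipticCurves.Module.lengthAt (IwasawaAlgebra 2) D.X
            ⟨IwasawaAlgebra.augIdealP 2, IwasawaAlgebra.isPrime_augIdealP_holds 2⟩ ≤
          Literature.NumberTheory.EllipticCurves.Module.lengthAt (IwasawaAlgebra 2)
              (IwasawaAlgebra 2 ⧸ Ideal.span {Gp})
              ⟨IwasawaAlgebra.augIdealP 2, IwasawaAlgebra.isPrime_augIdealP_holds 2⟩ +
            Literature.NumberTheory.EllipticCurves.Module.lengthAt (IwasawaAlgebra 2) Yr.X
              ⟨IwasawaAlgebra.augIdealP 2, IwasawaAlgebra.isPrime_augIdealP_holds 2⟩ := by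
  intro W _ _ hord ht κ γ hκ hγ hγ' N _ f hf Gp hGp D Yr
  let Yd : W.FineSelmerDualData κ γ := W.fineSelmerDualData κ hγ
  have h := hI W hord ht κ γ hκ hγ hγ' f hf Gp hGp D Yd
  have hle := RelaxedRestrict.lengthAt_fine_le_lengthAt_relaxed W κ hγ Yr Yd
    ⟨IwasawaAlgebra.augIdealP 2, IwasawaAlgebra.isPrime_augIdealP_holds 2⟩
  exact h.trans (by gcongr)

end Skeleton

end Summit.BirchSwinnertonDyer.BirchSwinnertonDyer.Theorems.AlignedTransportAtTwoFineRoad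

end
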